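/-
Copyright (c) 2026 the pub-hodgecm-mathlib formalisation cell (harness21).  Prover seat hodgecm-mathlib-F0P2-p01 (g15): road «S3-ram» (LEAD F0P3a-plan (g12); architect
A-p16 (g31); junction pen F0P3a-p01 (g17), J-PACK v2 03ef5f1f ROW-E; owner F0P3a-p06 (g15)); 2026-09-02.
-/
import Literature.NumberTheory.Automorphic.UnitaryLatticeTreeNilpotentVertexKernelTestRamified   -- ★ M₂ p847513 (this seat): kernel test; brings ★ M, L, K, I, H, G′, G, F, E, D
import Literature.NumberTheory.Automorphic.UnitaryLatticeTreeFixedChildPivotRamified          -- ★ J p847433 (this seat): eigenline, pivot, `not_lev_and_not_lev₂_childLatt_of_cube_le`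
import Literature.NumberTheory.Automorphic.UnitaryLatticeTreeFixedGrandchildrenCountRamified    -- ★ G3⁺ p847297 (F0P2-p06 (g12)): `ncard_fixedGrandchildren_eq_sq_of_level_two`, root-frame dictionary
import Literature.NumberTheory.Automorphic.UnitaryLatticeTreeResidualDatumRamified           -- ★ G3⁵ p847483 (F0P2-p06 (g13)): `map_pow_le_scaleLattice_latticeGraphIso_root_iff`
import HarnessLib

/-!
# The lattice graph of a hermitian space — ROW-E OF THE TREE INDUCTION (tame-ramified place): the fixed grandchildren of an EVEN-depth vertex `E_{m+1}` are `q²` vertices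
# of depth exactly `d − 1` and rank two (Bruhat–Tits 1972 §10; Tits 1979 §3.5; Kottwitz 1986 §3)

Topic `NumberTheory/Automorphic`; namespace `Literature.NumberTheory.Automorphic.UnitaryLatticeTree`.  THEOREMS ONLY (no definition, no instance, no notation, no named fact,
no `sorry`); kernel lane `--supports stmt-HodgeConjecture-24833`.  Cell `pub/hodgecm-mathlib` (D-0151), crux H413; road «S3-ram» (Literature seeding, count-neutral), organ
A′ (ii) of the P-1-ram skeleton (architect A-p16 (g31)); junction J-PACK v2 (F0P3a-p01 (g17)) **ROW-E** «EVEN VERTEX `E_{m+1}`», the `hE` hypothesis of the tree-induction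
engine ★ p847302 in TOKEN currency (sheet §1: `LEV[w] c := w.1.map (toLin'(γ−1)) ≤ scaleLattice c w.1`, `LEV₂`, `LEV₃` with `(γ−1)^2`, `(γ−1)^3`; common binders Ω of
★ p847357; orientation Ω⁺: a far vertex `g` through the INWARD neighbour `p` of `v` with `LEV[g](ϖ^d)`).  J₀-MODEL.

THE STATEMENT.  For a fixed self-dual vertex `v ≠ r₀` with `LEV[v](ϖ^d)`, `¬LEV[v](ϖ^{d+1})` (depth exactly `d`, `d` even, `d ≥ 2`) and `LEV₃[v](ϖ^{3d+1})` (residual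
nilpotency), oriented by `(p, g, hup)`: **every fixed grandchild `w ∈ GC(v)` has `LEV[w](ϖ^{d−1}) ∧ ¬LEV[w](ϖ^d) ∧ ¬LEV₂[w](ϖ^{2d−1})`** (label `(d − 1, rank 2)` = `O_m`) **and
`#GC(v) = q²`** — the law `E_{m+1} → q²·O_m` (CERT smoke v1.3 §6, A-p16 (g31)).  No `¬LEV₂[v]` hypothesis is needed: at even depth rank two is automatic (★ I).

THE PROOF (assembly of ★ organs).  `v = u·L₀` (★ transitivity); the inward side `p = (uκ₀)·N₁`, `g = latt((uκ₀)·g(a₀,b₀))` (★ L), so in the unitary frame `u₀ = uκ₀` the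
element `Y₀ = u₀⁻¹(γ−1)u₀` has level `ϖ^d`, is NOT of level `ϖ^{d+1}`, has `Y₀³` of level `ϖ^{3d+1}` (tokens ↔ matrices: ★ G3⁵ `map_pow_le_scaleLattice_latticeGraphIso_root_iff`),
and its first column vanishes residually (★ J §1 eigenline from `hup`, §2 kernel from nilpotency); hence the EVEN SHAPE `Ȳ₀ = γ′(E₁₂ − E₀₁)`, `γ′ ≠ 0` (★ M).  A grandchild
`w ∈ GC(v)` lies over an OUTWARD neighbour `c = (uκ)·N₁` (`dist` one MORE than `v`), `w = latt((uκ)·g(a,b))` (★ L); `c ≠ p` gives `k := κ₀⁻¹κ` with `k·N₁ ≠ N₁`, so by the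
kernel test (★ M₂) the first column of `k⁻¹Y₀k = (uκ)⁻¹(γ−1)(uκ)` does NOT vanish residually («the line of `c` is not in `ker Ȳ`»), while its corner `(2,0)` does (★ I:
even depth); ★ J `not_lev_and_not_lev₂_childLatt_of_cube_le` and ★ H `map_sub_one_childLatt_le_scaleLattice_pred_iff` give the three tokens at `w`; the count is ★ G3⁺
`ncard_fixedGrandchildren_eq_sq_of_level_two` (`LEV[v](ϖ²)` from `d ≥ 2`).

* `conj_mul_eq_inv_mul_conj_mul` (group bookkeeping), **`fixedGrandchildren_tokens_and_ncard_of_even`** (ROW-E).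

HONEST LABEL: HC_CM is proved only modulo the 2 remaining named inputs (hLiu418 24832, h413 24833) until rung 0 closes; nothing printed is asserted here (elementary lattice
bookkeeping over a valuation ring); «S3-ram» has no books consequence.

## References
* [BruhatTits1972] F. Bruhat, J. Tits, *Groupes réductifs sur un corps local I*, Publ. Math. IHÉS 41 (1972), §10 (lattice models; vertex stabilisers and their filtrations).
* [Tits1979] J. Tits, *Reductive groups over local fields*, PSPM 33.1 (1979), §3.5 (congruence filtration; reduction mod `𝔭`).
* [Kottwitz1986] R. E. Kottwitz, *Base change for unit elements of Hecke algebras*, Compositio Math. 60 (1986), §3 (counting fixed lattices shell by shell).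
* [Serre1980Trees] J.-P. Serre, *Trees* (1980), Ch. II §1.1 (neighbours of a lattice = lines of its reduction; balls in the tree).
-/

set_option autoImplicit false

noncomputable section

open scoped Valued WithZero Matrix MatrixGroups

namespace Literature.NumberTheory.Automorphic.UnitaryLatticeTree

open Literature.NumberTheory.Automorphic Literature.NumberTheory.Automorphic.HermitianLattice

variable {K : Type*} [Field K] [Valued K ℤᵐ⁰] {σ : K →+* K} {ϖ : K}

omit [Valued K ℤᵐ⁰] in
/-- Group bookkeeping: `(u₀k)⁻¹γ(u₀k) = k⁻¹(u₀⁻¹γu₀)k`. [cite: Serre1980Trees, II.1.1] -/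
theorem conj_mul_eq_inv_mul_conj_mul {H : Matrix (Fin 3) (Fin 3) K} (γ u₀ k : unitaryGroupOfForm σ H) :
    (u₀ * k)⁻¹ * γ * (u₀ * k) = k⁻¹ * (u₀⁻¹ * γ * u₀) * k := by
  group

/-- **ROW-E «EVEN VERTEX `E_{m+1}`»** of the (a2) tree induction, token currency (J-PACK v2 §2): for a fixed self-dual vertex `v ≠ r₀` of depth exactly `d` (`d` even,
`d ≥ 2`: `LEV[v](ϖ^d)`, `¬LEV[v](ϖ^{d+1})`), residually nilpotent (`LEV₃[v](ϖ^{3d+1})`), oriented (`p` the inward neighbour, `g ≠ v` a vertex through `p` with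
`LEV[g](ϖ^d)`): every fixed grandchild `w ∈ GC(v)` satisfies `LEV[w](ϖ^{d−1}) ∧ ¬LEV[w](ϖ^d) ∧ ¬LEV₂[w](ϖ^{2d−1})`, and `#GC(v) = q²`.
[cite: Kottwitz1986, §3] [cite: Tits1979, §3.5] [cite: BruhatTits1972, §10] [cite: Serre1980Trees, II.1.1] -/
theorem fixedGrandchildren_tokens_and_ncard_of_even (hσ : ∀ x, σ (σ x) = x) (hvσ : ∀ a, Valued.v (σ a) = Valued.v a) (hσϖ : σ ϖ = -ϖ)
    (hϖ : Valued.v ϖ = WithZero.exp (-1 : ℤ)) (hres : ∀ x : K, Valued.v x ≤ 1 → Valued.v (σ x - x) < 1) (h2 : Valued.v (2 : K) = 1) [Finite 𝓀[K]]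
    (hT : (latticeGraph σ ϖ ((StdForm.antidiagonal 3).over K)).IsTree)
    {γ : unitaryGroupOfForm σ ((StdForm.antidiagonal 3).over K)} (_hγ0 : γ ∈ unitaryInt σ ((StdForm.antidiagonal 3).over K))
    {v : {M : Submodule 𝒪[K] (Fin 3 → K) // IsVertex σ ϖ ((StdForm.antidiagonal 3).over K) M}}
    (hv : IsSelfDualLattice σ ϖ ((StdForm.antidiagonal 3).over K) v.1) (hvr : v ≠ ⟨stdLattice K 3, 0, isSelfDualLattice_stdLattice_three_of_v hϖ⟩)
    (hfix : latticeGraphIso σ ϖ ((StdForm.antidiagonal 3).over K) γ v = v)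
    {d : ℕ} (hd2 : 2 ≤ d) (hde : Even d)
    {p g : {M : Submodule 𝒪[K] (Fin 3 → K) // IsVertex σ ϖ ((StdForm.antidiagonal 3).over K) M}}
    (hp : (latticeGraph σ ϖ ((StdForm.antidiagonal 3).over K)).Adj v p)
    (hpin : (latticeGraph σ ϖ ((StdForm.antidiagonal 3).over K)).dist ⟨stdLattice K 3, 0, isSelfDualLattice_stdLattice_three_of_v hϖ⟩ p + 1 =
      (latticeGraph σ ϖ ((StdForm.antidiagonal 3).over K)).dist ⟨stdLattice K 3, 0, isSelfDualLattice_stdLattice_three_of_v hϖ⟩ v)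
    (hg : (latticeGraph σ ϖ ((StdForm.antidiagonal 3).over K)).Adj p g) (hgv : g ≠ v)
    (hup : g.1.map ((Matrix.toLin' (((γ : GL (Fin 3) K) : Matrix (Fin 3) (Fin 3) K) - 1)).restrictScalars 𝒪[K]) ≤ scaleLattice (ϖ ^ d) g.1)
    (hlev : v.1.map ((Matrix.toLin' (((γ : GL (Fin 3) K) : Matrix (Fin 3) (Fin 3) K) - 1)).restrictScalars 𝒪[K]) ≤ scaleLattice (ϖ ^ d) v.1)
    (hexact : ¬ v.1.map ((Matrix.toLin' (((γ : GL (Fin 3) K) : Matrix (Fin 3) (Fin 3) K) - 1)).restrictScalars 𝒪[K]) ≤ scaleLattice (ϖ ^ (d + 1)) v.1)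
    (_hrk : ¬ v.1.map ((Matrix.toLin' ((((γ : GL (Fin 3) K) : Matrix (Fin 3) (Fin 3) K) - 1) ^ 2)).restrictScalars 𝒪[K]) ≤ scaleLattice (ϖ ^ (2 * d + 1)) v.1)
    (hnil : v.1.map ((Matrix.toLin' ((((γ : GL (Fin 3) K) : Matrix (Fin 3) (Fin 3) K) - 1) ^ 3)).restrictScalars 𝒪[K]) ≤ scaleLattice (ϖ ^ (3 * d + 1)) v.1) :
    (∀ w ∈ {w | ∃ c, ((latticeGraph σ ϖ ((StdForm.antidiagonal 3).over K)).Adj v c ∧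
          (latticeGraph σ ϖ ((StdForm.antidiagonal 3).over K)).dist ⟨stdLattice K 3, 0, isSelfDualLattice_stdLattice_three_of_v hϖ⟩ c =
            (latticeGraph σ ϖ ((StdForm.antidiagonal 3).over K)).dist ⟨stdLattice K 3, 0, isSelfDualLattice_stdLattice_three_of_v hϖ⟩ v + 1 ∧
          latticeGraphIso σ ϖ ((StdForm.antidiagonal 3).over K) γ c = c) ∧
        ((latticeGraph σ ϖ ((StdForm.antidiagonal 3).over K)).Adj c w ∧
          (latticeGraph σ ϖ ((StdForm.antidiagonal 3).over K)).dist ⟨stdLattice K 3, 0, isSelfDualLattice_stdLattice_three_of_v hϖ⟩ w =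
            (latticeGraph σ ϖ ((StdForm.antidiagonal 3).over K)).dist ⟨stdLattice K 3, 0, isSelfDualLattice_stdLattice_three_of_v hϖ⟩ c + 1 ∧
          latticeGraphIso σ ϖ ((StdForm.antidiagonal 3).over K) γ w = w)},
      w.1.map ((Matrix.toLin' (((γ : GL (Fin 3) K) : Matrix (Fin 3) (Fin 3) K) - 1)).restrictScalars 𝒪[K]) ≤ scaleLattice (ϖ ^ (d - 1)) w.1 ∧
      ¬ w.1.map ((Matrix.toLin' (((γ : GL (Fin 3) K) : Matrix (Fin 3) (Fin 3) K) - 1)).restrictScalars 𝒪[K]) ≤ scaleLattice (ϖ ^ d) w.1 ∧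
      ¬ w.1.map ((Matrix.toLin' ((((γ : GL (Fin 3) K) : Matrix (Fin 3) (Fin 3) K) - 1) ^ 2)).restrictScalars 𝒪[K]) ≤ scaleLattice (ϖ ^ (2 * d - 1)) w.1) ∧
    {w | ∃ c, ((latticeGraph σ ϖ ((StdForm.antidiagonal 3).over K)).Adj v c ∧
          (latticeGraph σ ϖ ((StdForm.antidiagonal 3).over K)).dist ⟨stdLattice K 3, 0, isSelfDualLattice_stdLattice_three_of_v hϖ⟩ c =
            (latticeGraph σ ϖ ((StdForm.antidiagonal 3).over K)).dist ⟨stdLattice K 3, 0, isSelfDualLattice_stdLattice_three_of_v hϖ⟩ v + 1 ∧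
          latticeGraphIso σ ϖ ((StdForm.antidiagonal 3).over K) γ c = c) ∧
        ((latticeGraph σ ϖ ((StdForm.antidiagonal 3).over K)).Adj c w ∧
          (latticeGraph σ ϖ ((StdForm.antidiagonal 3).over K)).dist ⟨stdLattice K 3, 0, isSelfDualLattice_stdLattice_three_of_v hϖ⟩ w =
            (latticeGraph σ ϖ ((StdForm.antidiagonal 3).over K)).dist ⟨stdLattice K 3, 0, isSelfDualLattice_stdLattice_three_of_v hϖ⟩ c + 1 ∧
          latticeGraphIso σ ϖ ((StdForm.antidiagonal 3).over K) γ w = w)}.ncard = Nat.card 𝓀[K] ^ 2 := by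
  have hϖ0 : ϖ ≠ 0 := fun h0 => by rw [h0, map_zero] at hϖ; exact WithZero.coe_ne_zero hϖ.symm
  have hvϖ0 : Valued.v ϖ ≠ 0 := (Valuation.ne_zero_iff _).2 hϖ0
  have hϖ1 : Valued.v ϖ ≤ 1 := by rw [hϖ, ← WithZero.exp_zero]; exact WithZero.exp_le_exp.2 (by norm_num)
  have hϖlt : Valued.v ϖ < 1 := by rw [hϖ, ← WithZero.exp_zero]; exact WithZero.exp_lt_exp.2 (by norm_num)
  have hd1 : 1 ≤ d := by omega
  have hpowle : ∀ {m n : ℕ}, n ≤ m → Valued.v ϖ ^ m ≤ Valued.v ϖ ^ n := fun {m n} h => pow_le_pow_right_of_le_one' hϖ1 h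
  -- the frame of `v`
  obtain ⟨u, hu⟩ := exists_latticeGraphIso_root_eq_of_v_two hσ hvσ hϖ h2 v hv (isSelfDualLattice_stdLattice_three_of_v hϖ)
  subst hu
  -- matrices in a unitary frame `F` of `v`: tokens ↔ entrywise bounds (★ G3⁵)
  have hframe : ∀ {κ : unitaryGroupOfForm σ ((StdForm.antidiagonal 3).over K)}, κ ∈ unitaryInt σ ((StdForm.antidiagonal 3).over K) →
      latticeGraphIso σ ϖ ((StdForm.antidiagonal 3).over K) (u * κ) ⟨stdLattice K 3, 0, isSelfDualLattice_stdLattice_three_of_v hϖ⟩ =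
        latticeGraphIso σ ϖ ((StdForm.antidiagonal 3).over K) u ⟨stdLattice K 3, 0, isSelfDualLattice_stdLattice_three_of_v hϖ⟩ := fun {κ} hκ => by
    rw [latticeGraphIso_mul_apply, latticeGraphIso_root_eq_of_mem_unitaryInt hϖ hκ]
  -- token ↔ matrix dictionary in the frame `u * κ`, powers `1` and `3`
  have hY : ∀ {κ : unitaryGroupOfForm σ ((StdForm.antidiagonal 3).over K)}, κ ∈ unitaryInt σ ((StdForm.antidiagonal 3).over K) →
      ∀ i j, Valued.v ((((((u * κ)⁻¹ * γ * (u * κ) : unitaryGroupOfForm σ ((StdForm.antidiagonal 3).over K)) : GL (Fin 3) K) : Matrix (Fin 3) (Fin 3) K) - 1) i j) ≤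
        Valued.v ϖ ^ d := fun {κ} hκ => by
    have h := (map_pow_le_scaleLattice_latticeGraphIso_root_iff hϖ γ (u * κ) (pow_ne_zero d hϖ0) 1).1 (by rw [pow_one, hframe hκ]; exact hlev)
    simpa only [pow_one, map_pow] using h
  have hY3 : ∀ {κ : unitaryGroupOfForm σ ((StdForm.antidiagonal 3).over K)}, κ ∈ unitaryInt σ ((StdForm.antidiagonal 3).over K) →
      ∀ i j, Valued.v (((((((u * κ)⁻¹ * γ * (u * κ) : unitaryGroupOfForm σ ((StdForm.antidiagonal 3).over K)) : GL (Fin 3) K) : Matrix (Fin 3) (Fin 3) K) - 1) *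
        (((((u * κ)⁻¹ * γ * (u * κ) : unitaryGroupOfForm σ ((StdForm.antidiagonal 3).over K)) : GL (Fin 3) K) : Matrix (Fin 3) (Fin 3) K) - 1) *
        (((((u * κ)⁻¹ * γ * (u * κ) : unitaryGroupOfForm σ ((StdForm.antidiagonal 3).over K)) : GL (Fin 3) K) : Matrix (Fin 3) (Fin 3) K) - 1)) i j) ≤
        Valued.v ϖ ^ (3 * d + 1) := fun {κ} hκ => by
    have h := (map_pow_le_scaleLattice_latticeGraphIso_root_iff hϖ γ (u * κ) (pow_ne_zero _ hϖ0) 3).1 (by rw [hframe hκ]; exact hnil)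
    simpa only [pow_three', map_pow] using h
  have hYne : ∀ {κ : unitaryGroupOfForm σ ((StdForm.antidiagonal 3).over K)}, κ ∈ unitaryInt σ ((StdForm.antidiagonal 3).over K) →
      ¬ ∀ i j, Valued.v ((((((u * κ)⁻¹ * γ * (u * κ) : unitaryGroupOfForm σ ((StdForm.antidiagonal 3).over K)) : GL (Fin 3) K) : Matrix (Fin 3) (Fin 3) K) - 1) i j) ≤
        Valued.v ϖ ^ (d + 1) := fun {κ} hκ h => by
    apply hexact
    have h' := (map_pow_le_scaleLattice_latticeGraphIso_root_iff hϖ γ (u * κ) (pow_ne_zero (d + 1) hϖ0) 1).2 (by simpa only [pow_one, map_pow] using h)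
    rwa [pow_one, hframe hκ] at h'
  -- ORIENTATION: the inward side `p = (uκ₀)·N₁`, `g = latt((uκ₀)·g(a₀,b₀))`; the frame `u₀ := uκ₀` is adapted to the inward line
  obtain ⟨κ₀, hκ₀, a₀, b₀, ha₀, hb₀, hp_eq, hg_eq⟩ := exists_frame_of_adj_adj hσ hvσ hσϖ hϖ hres h2 u rfl hp hg hgv
  set γ₀ : unitaryGroupOfForm σ ((StdForm.antidiagonal 3).over K) := (u * κ₀)⁻¹ * γ * (u * κ₀) with hγ₀def
  have hM₀ : (((γ₀ : GL (Fin 3) K) : Matrix (Fin 3) (Fin 3) K) - 1) =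
      ((((u * κ₀ : unitaryGroupOfForm σ ((StdForm.antidiagonal 3).over K)) : GL (Fin 3) K)⁻¹ : GL (Fin 3) K) : Matrix (Fin 3) (Fin 3) K) *
        (((γ : GL (Fin 3) K) : Matrix (Fin 3) (Fin 3) K) - 1) * (((u * κ₀ : unitaryGroupOfForm σ ((StdForm.antidiagonal 3).over K)) : GL (Fin 3) K) : Matrix (Fin 3) (Fin 3) K) :=
    coe_inv_mul_mul_sub_one γ (u * κ₀)
  have hY₀ := hY hκ₀
  have hY₀3 := hY3 hκ₀
  have hY₀ne := hYne hκ₀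
  -- the inward line is in the kernel: ★ J §1 (eigenline from `hup`) + §2 (nilpotency)
  have hcol₀ : ∀ i, Valued.v ((((γ₀ : GL (Fin 3) K) : Matrix (Fin 3) (Fin 3) K) - 1) i 0) ≤ Valued.v ϖ ^ (d + 1) := by
    have hup' := hup
    rw [hg_eq] at hup'
    have hM₀' : ∀ i j, Valued.v ((((((u * κ₀ : unitaryGroupOfForm σ ((StdForm.antidiagonal 3).over K)) : GL (Fin 3) K)⁻¹ : GL (Fin 3) K) : Matrix (Fin 3) (Fin 3) K) *
        (((γ : GL (Fin 3) K) : Matrix (Fin 3) (Fin 3) K) - 1) * (((u * κ₀ : unitaryGroupOfForm σ ((StdForm.antidiagonal 3).over K)) : GL (Fin 3) K) : Matrix (Fin 3) (Fin 3) K)) i j) ≤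
        Valued.v ϖ ^ d := fun i j => by rw [← hM₀]; exact hY₀ i j
    obtain ⟨h10, -, h20⟩ := v_apply_le_succ_of_map_sub_one_childLatt_le hϖ ((u * κ₀ : unitaryGroupOfForm σ ((StdForm.antidiagonal 3).over K)) : GL (Fin 3) K)
      (γ : GL (Fin 3) K) ha₀ hb₀ hd1 hM₀' hup'
    have hcube' : ∀ i j, Valued.v (((((((u * κ₀ : unitaryGroupOfForm σ ((StdForm.antidiagonal 3).over K)) : GL (Fin 3) K)⁻¹ : GL (Fin 3) K) : Matrix (Fin 3) (Fin 3) K) *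
        (((γ : GL (Fin 3) K) : Matrix (Fin 3) (Fin 3) K) - 1) * (((u * κ₀ : unitaryGroupOfForm σ ((StdForm.antidiagonal 3).over K)) : GL (Fin 3) K) : Matrix (Fin 3) (Fin 3) K)) *
        (((((u * κ₀ : unitaryGroupOfForm σ ((StdForm.antidiagonal 3).over K)) : GL (Fin 3) K)⁻¹ : GL (Fin 3) K) : Matrix (Fin 3) (Fin 3) K) *
        (((γ : GL (Fin 3) K) : Matrix (Fin 3) (Fin 3) K) - 1) * (((u * κ₀ : unitaryGroupOfForm σ ((StdForm.antidiagonal 3).over K)) : GL (Fin 3) K) : Matrix (Fin 3) (Fin 3) K)) *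
        (((((u * κ₀ : unitaryGroupOfForm σ ((StdForm.antidiagonal 3).over K)) : GL (Fin 3) K)⁻¹ : GL (Fin 3) K) : Matrix (Fin 3) (Fin 3) K) *
        (((γ : GL (Fin 3) K) : Matrix (Fin 3) (Fin 3) K) - 1) * (((u * κ₀ : unitaryGroupOfForm σ ((StdForm.antidiagonal 3).over K)) : GL (Fin 3) K) : Matrix (Fin 3) (Fin 3) K))) i j) ≤
        Valued.v ϖ ^ (3 * d + 1) := fun i j => by rw [← hM₀]; exact hY₀3 i j
    -- all of column 0: if not, ★ J's pivot `|M₁₀| = |ϖ|^d` contradicts `h10`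
    have hall : ∀ i, Valued.v ((((((u * κ₀ : unitaryGroupOfForm σ ((StdForm.antidiagonal 3).over K)) : GL (Fin 3) K)⁻¹ : GL (Fin 3) K) : Matrix (Fin 3) (Fin 3) K) *
        (((γ : GL (Fin 3) K) : Matrix (Fin 3) (Fin 3) K) - 1) * (((u * κ₀ : unitaryGroupOfForm σ ((StdForm.antidiagonal 3).over K)) : GL (Fin 3) K) : Matrix (Fin 3) (Fin 3) K)) i 0) ≤
        Valued.v ϖ ^ (d + 1) := by
      by_contra hnot
      have hpiv := v_one_zero_eq_of_cube_le_of_corner hϖ hM₀' hcube' h20 hnot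
      have hlt : Valued.v ϖ ^ (d + 1) < Valued.v ϖ ^ d := by
        rw [pow_succ]; exact mul_lt_of_lt_one_right (zero_lt_iff.2 (pow_ne_zero _ hvϖ0)) hϖlt
      exact (lt_irrefl _) ((h10.trans_lt hlt).trans_eq hpiv.symm)
    intro i; rw [hM₀]; exact hall i
  -- the EVEN SHAPE in the frame `u₀`: pivots `|Y₀ 1 2| = |Y₀ 0 1| = |ϖ|^d`, every other entry but `(0,2)`… off `{(0,1),(1,2)}` small
  obtain ⟨h12, h01⟩ := v_coe_sub_one_one_two_eq_of_even_of_col hvσ hσϖ hϖ hres h2 γ₀ hde hd1 hY₀ hcol₀ hY₀ne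
  have hshape : ∀ i j : Fin 3, ¬ (i = 0 ∧ j = 1) → ¬ (i = 1 ∧ j = 2) → ¬ (i = 0 ∧ j = 2) →
      Valued.v ((((γ₀ : GL (Fin 3) K) : Matrix (Fin 3) (Fin 3) K) - 1) i j) ≤ Valued.v ϖ ^ (d + 1) :=
    fun i j hij hij' _ => forall_v_coe_sub_one_le_succ_of_even_of_col hvσ hσϖ hϖ hres h2 γ₀ hde hd1 hY₀ hcol₀ hij hij'
  refine ⟨?_, ?_⟩
  · -- LABELS of a grandchild
    rintro w ⟨c, ⟨hvc, hdc, -⟩, hcw, hdw, -⟩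
    have hne : w ≠ latticeGraphIso σ ϖ ((StdForm.antidiagonal 3).over K) u ⟨stdLattice K 3, 0, isSelfDualLattice_stdLattice_three_of_v hϖ⟩ := by
      intro h; rw [h] at hdw; omega
    obtain ⟨κ, hκ, a, b, ha, hb, hc_eq, hw_eq⟩ := exists_frame_of_adj_adj hσ hvσ hσϖ hϖ hres h2 u rfl hvc hcw hne
    -- `c ≠ p` (outward vs inward), so `k := κ₀⁻¹κ` moves `N₁`
    have hcp : c ≠ p := by intro h; rw [h] at hdc; omega
    set k : unitaryGroupOfForm σ ((StdForm.antidiagonal 3).over K) := κ₀⁻¹ * κ with hkdef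
    have hk : k ∈ unitaryInt σ ((StdForm.antidiagonal 3).over K) := Subgroup.mul_mem _ (Subgroup.inv_mem _ hκ₀) hκ
    have hkN : ¬ Valued.v (((k : GL (Fin 3) K) : Matrix (Fin 3) (Fin 3) K) 2 0) < 1 := by
      intro hlt
      have hkN₁ := (mapGL_N₁_eq_iff_v_apply_two_zero_lt_one hvσ hϖ hk).2 hlt
      apply hcp
      rw [hc_eq, hp_eq, show u * κ = u * κ₀ * k by rw [hkdef, mul_assoc, mul_inv_cancel_left], latticeGraphIso_mul_apply]
      congr 1
      exact Subtype.ext (by rw [latticeGraphIso_apply_val]; exact hkN₁)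
    -- the matrix in the frame `uκ = u₀k` is `k⁻¹Y₀k`
    have hconj : (u * κ)⁻¹ * γ * (u * κ) = k⁻¹ * γ₀ * k := by
      rw [hγ₀def, show u * κ = u * κ₀ * k by rw [hkdef, mul_assoc, mul_inv_cancel_left]]
      exact conj_mul_eq_inv_mul_conj_mul γ (u * κ₀) k
    have hMk : ((((u * κ : unitaryGroupOfForm σ ((StdForm.antidiagonal 3).over K)) : GL (Fin 3) K)⁻¹ : GL (Fin 3) K) : Matrix (Fin 3) (Fin 3) K) *
          (((γ : GL (Fin 3) K) : Matrix (Fin 3) (Fin 3) K) - 1) * (((u * κ : unitaryGroupOfForm σ ((StdForm.antidiagonal 3).over K)) : GL (Fin 3) K) : Matrix (Fin 3) (Fin 3) K) =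
        (((k : GL (Fin 3) K)⁻¹ : GL (Fin 3) K) : Matrix (Fin 3) (Fin 3) K) * (((γ₀ : GL (Fin 3) K) : Matrix (Fin 3) (Fin 3) K) - 1) * ((k : GL (Fin 3) K) : Matrix (Fin 3) (Fin 3) K) := by
      rw [← coe_inv_mul_mul_sub_one γ (u * κ), ← coe_inv_mul_mul_sub_one γ₀ k, hconj]
    -- level `ϖ^d` and cube bound in the frame `uκ`
    have hM : ∀ i j, Valued.v ((((((u * κ : unitaryGroupOfForm σ ((StdForm.antidiagonal 3).over K)) : GL (Fin 3) K)⁻¹ : GL (Fin 3) K) : Matrix (Fin 3) (Fin 3) K) *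
        (((γ : GL (Fin 3) K) : Matrix (Fin 3) (Fin 3) K) - 1) * (((u * κ : unitaryGroupOfForm σ ((StdForm.antidiagonal 3).over K)) : GL (Fin 3) K) : Matrix (Fin 3) (Fin 3) K)) i j) ≤
        Valued.v ϖ ^ d := fun i j => by rw [← coe_inv_mul_mul_sub_one γ (u * κ)]; exact hY hκ i j
    -- NOT KERNEL: the first column of `k⁻¹Y₀k` does not vanish residually (★ M₂)
    have hcol : ¬ ∀ i, Valued.v ((((((u * κ : unitaryGroupOfForm σ ((StdForm.antidiagonal 3).over K)) : GL (Fin 3) K)⁻¹ : GL (Fin 3) K) : Matrix (Fin 3) (Fin 3) K) *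
        (((γ : GL (Fin 3) K) : Matrix (Fin 3) (Fin 3) K) - 1) * (((u * κ : unitaryGroupOfForm σ ((StdForm.antidiagonal 3).over K)) : GL (Fin 3) K) : Matrix (Fin 3) (Fin 3) K)) i 0) ≤
        Valued.v ϖ ^ (d + 1) := by
      rw [hMk]
      exact fun h => hkN ((forall_v_conj_apply_zero_le_succ_iff hvσ hϖ hY₀ hshape h12 h01 hk).1 h)
    -- the CORNER passes at even depth (★ I)
    have h20 : Valued.v ((((((u * κ : unitaryGroupOfForm σ ((StdForm.antidiagonal 3).over K)) : GL (Fin 3) K)⁻¹ : GL (Fin 3) K) : Matrix (Fin 3) (Fin 3) K) *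
        (((γ : GL (Fin 3) K) : Matrix (Fin 3) (Fin 3) K) - 1) * (((u * κ : unitaryGroupOfForm σ ((StdForm.antidiagonal 3).over K)) : GL (Fin 3) K) : Matrix (Fin 3) (Fin 3) K)) 2 0) ≤
        Valued.v ϖ ^ (d + 1) := by
      rw [← coe_inv_mul_mul_sub_one γ (u * κ)]
      exact v_coe_sub_one_rev_apply_le_of_even hvσ hσϖ hϖ hres h2 ((u * κ)⁻¹ * γ * (u * κ)) hde hd1 (hY hκ) 0
    -- the tokens of `v` at `latt (uκ)`
    have hlev' : (latt (((u * κ : unitaryGroupOfForm σ ((StdForm.antidiagonal 3).over K)) : GL (Fin 3) K) : Matrix (Fin 3) (Fin 3) K)).map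
          ((Matrix.toLin' (((γ : GL (Fin 3) K) : Matrix (Fin 3) (Fin 3) K) - 1)).restrictScalars 𝒪[K]) ≤
        scaleLattice (ϖ ^ d) (latt (((u * κ : unitaryGroupOfForm σ ((StdForm.antidiagonal 3).over K)) : GL (Fin 3) K) : Matrix (Fin 3) (Fin 3) K)) := by
      have h := hlev
      rw [← hframe hκ] at h
      exact h
    have hnil' : (latt (((u * κ : unitaryGroupOfForm σ ((StdForm.antidiagonal 3).over K)) : GL (Fin 3) K) : Matrix (Fin 3) (Fin 3) K)).map
          ((Matrix.toLin' ((((γ : GL (Fin 3) K) : Matrix (Fin 3) (Fin 3) K) - 1) ^ 3)).restrictScalars 𝒪[K]) ≤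
        scaleLattice (ϖ ^ (3 * d + 1)) (latt (((u * κ : unitaryGroupOfForm σ ((StdForm.antidiagonal 3).over K)) : GL (Fin 3) K) : Matrix (Fin 3) (Fin 3) K)) := by
      have h := hnil
      rw [← hframe hκ] at h
      exact h
    obtain ⟨hnotlev, hnotlev₂⟩ := not_lev_and_not_lev₂_childLatt_of_cube_le hvσ hϖ (u * κ) γ ha hb hd1 hlev' hnil' h20 hcol
    have hlevpred := (map_sub_one_childLatt_le_scaleLattice_pred_iff hϖ ((u * κ : unitaryGroupOfForm σ ((StdForm.antidiagonal 3).over K)) : GL (Fin 3) K)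
      (γ : GL (Fin 3) K) ha hb hd1 hM).2 h20
    rw [hw_eq]
    exact ⟨hlevpred, hnotlev, hnotlev₂⟩
  · -- COUNT (★ G3⁺): `LEV[v](ϖ²)` from `d ≥ 2`
    have hlev2 : (latticeGraphIso σ ϖ ((StdForm.antidiagonal 3).over K) u ⟨stdLattice K 3, 0, isSelfDualLattice_stdLattice_three_of_v hϖ⟩).1.map
          ((Matrix.toLin' (((γ : GL (Fin 3) K) : Matrix (Fin 3) (Fin 3) K) - 1)).restrictScalars 𝒪[K]) ≤
        scaleLattice (ϖ ^ 2) (latticeGraphIso σ ϖ ((StdForm.antidiagonal 3).over K) u ⟨stdLattice K 3, 0, isSelfDualLattice_stdLattice_three_of_v hϖ⟩).1 := by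
      have h1 := (forall_v_conj_sub_one_le_iff_map_sub_one_le_scaleLattice γ u (pow_ne_zero d hϖ0)).1 hlev
      exact (forall_v_conj_sub_one_le_iff_map_sub_one_le_scaleLattice γ u (pow_ne_zero 2 hϖ0)).2
        (fun i j => (h1 i j).trans (by rw [map_pow, map_pow]; exact hpowle hd2))
    exact ncard_fixedGrandchildren_eq_sq_of_level_two hσ hvσ hσϖ hϖ hres h2 hT hv hvr hfix hlev2

end Literature.NumberTheory.Automorphic.UnitaryLatticeTree

end
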